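import Literature.AlgebraicGeometry.Resolution.FittingRankStrata
import Literature.AlgebraicGeometry.Resolution.BlowupsCompositionFiniteType
import Literature.AlgebraicGeometry.Resolution.SeparatingBlowupFinite
import Mathlib.AlgebraicGeometry.Morphisms.Affine
import Mathlib.AlgebraicGeometry.Morphisms.QuasiSeparated
import Mathlib.Algebra.Category.Ring.Constructions
import Mathlib.RingTheory.IsTensorProduct
import HarnessLib

/-!
# Stacks 081R for finite, finitely presented morphisms (Raynaud–Gruson flattening)

Topic: `Literature/AlgebraicGeometry/Resolution`. **Theorem**
(`stacks081R_of_isFinite_of_locallyOfFinitePresentation`, `stacks081R_of_isFinite`). Let `S` be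
quasi-compact and quasi-separated, `f : X → S` finite and locally of finite presentation,
`U ⊆ S` a quasi-compact open with `X_U → U` flat. Then there are an ideal sheaf of finite type
`𝓘` with `V(𝓘) ∩ U = ∅` and a blowing up `b : S' → S` of `S` in `𝓘` (a `U`-admissible blowing
up) such that the strict transform of `X` along `b` is flat and locally of finite presentation
over `S'` — the named fact `Stacks081R` (Raynaud–Gruson 1971, Thm. 5.2.2) for finite morphisms
of finite presentation.

Proof (Stacks 0811): the rank strata `U_r = U ∩ S_r(f)` (`FittingRankStrata.lean`) are finitely
many pairwise disjoint quasi-compact opens covering `U` (flatness is used only here); a first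
`U`-admissible blowing up `b₁ : S₁ → S` (in `𝓚 · 𝓒₁`, `V(𝓚) = S ∖ U`, `𝓒₁` the separating
centre of `SeparatingBlowupFinite.lean`) splits `S₁ = T_0 ⊔ … ⊔ T_{N-1}` into clopen pieces with
`b₁⁻¹(U_r) ⊆ T_r`, so that `X ×_S S₁` has constant rank `r` over `b₁⁻¹U ∩ T_r` (rank strata pull
back, Part 1); a second blowing up `b₂ : S₂ → S₁` in `𝓚₁ · ∏_r (𝓛_r + 𝓚₁ · Fit_r)`
(`𝓚₁ = 𝓚𝓒₁ 𝒪_{S₁}`, `𝓛_r` the ideal of `T_r`, Part 2), which over `T_r` is the Fitting-ideal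
centre of `StrictTransformFiniteFlatteningQcqs.lean`, flattens the strict transform
(base-locality of strict transforms); and `b₂ ≫ b₁` is a blowing up in a finite type multiple `𝓘`
of `𝓚𝓒₁` (Stacks 080B), `V(𝓘) = S ∖ U`, whose strict transform is that of `X ×_S S₁` along `b₂`.

Part 1 — Fitting ideal sheaves and rank strata under base change:
* `fittingIdeal_eq_map_of_isPushout` — Fitting ideals along a pushout square of rings;
* `fittingIdealSheaf_comap_ideal_top_of_le` — `Fit_k(f_*𝒪_X)|_T(T) = Fit_k(Γ(X ×_S T))` for an
  affine chart `T → S` landing in an affine open (`Γ(X ×_S T) = Γ(T) ⊗ Γ(f⁻¹W)`,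
  `isPushout_appTop_of_isPullback`);
* `preimage_rankStratum_le` — `b⁻¹(S_r(f)) ⊆ S_r(X ×_S S₁ → S₁)`.
Part 2 — preliminaries for the assembly:
* `ker_ι_ideal_eq_bot_of_le`, `ker_ι_ideal_eq_top_of_inf_eq_bot` — the ideal of a quasi-compact
  (cl)open;
* `fittingIdealSheaf_comap_of_isOpenImmersion` — `Fit_k(f_*𝒪_X)|_T = Fit_k((f_T)_*𝒪_{X_T})`;
* `compactSpace_of_isBlowup_of_fg`, `quasiSeparatedSpace_of_isBlowup_of_fg`.
Part 3 — the theorem.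

## References

* The Stacks Project, Tag 081R (Lemma 38.31.1), Tag 0811, Tag 080P, Tag 080B, Tag 0C3D,
  Tag 07ZA. [StacksProject]
* M. Raynaud, L. Gruson, *Critères de platitude et de projectivité*, Invent. Math. 13 (1971),
  Première partie, Thm. 5.2.2. [RaynaudGruson1971]
-/

noncomputable section

open CategoryTheory CategoryTheory.Limits AlgebraicGeometry TopologicalSpace

namespace Literature.AlgebraicGeometry.Resolution

universe u

/-! # Part 1 — Fitting ideal sheaves and rank strata under base change -/

open Literature.RingTheory.FittingIdeal Literature.AlgebraicGeometry.Limits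
  Literature.AlgebraicGeometry.Morphisms TensorProduct

/-! ## Fitting ideals along a pushout square of rings -/

/-- **Fitting ideals commute with base change, pushout-square form**: for a pushout square of
commutative rings `R → S`, `R → T`, `S → P`, `T → P` with `R → S` finite,
`Fit_k^T(P) = Fit_k^R(S) · T`. [cite: StacksProject, Tag 07ZA] -/
theorem fittingIdeal_eq_map_of_isPushout {R S T P : CommRingCat.{u}} {φ : R ⟶ S} {g : R ⟶ T}
    {inl : S ⟶ P} {inr : T ⟶ P} (h : IsPushout φ g inl inr) (hfin : φ.hom.Finite) (k : ℕ) :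
    (letI := inr.hom.toAlgebra; Module.fittingIdeal T P k) =
      (letI := φ.hom.toAlgebra; Module.fittingIdeal R S k).map g.hom := by
  algebraize [φ.hom, g.hom, inl.hom, inr.hom, inl.hom.comp φ.hom]
  have : IsScalarTower R T P := .of_algebraMap_eq' <| congr($(h.1.1).hom)
  have hpo : Algebra.IsPushout R T S P := CommRingCat.isPushout_iff_isPushout.mp h.flip
  -- `P ≅ T ⊗_R S` as `T`-modules
  let e : T ⊗[R] S ≃ₗ[T] P := (Algebra.IsPushout.equiv R T S P).toLinearEquiv
  rw [← Module.fittingIdeal_eq_of_linearEquiv e k, Module.fittingIdeal_baseChange]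
  rfl

/-! ## The Fitting ideal sheaf on an affine chart of a base change -/

section Chart

variable {X S T : Scheme.{u}} (f : X ⟶ S) [IsFinite f] [IsAffine T] (ι : T ⟶ S)

omit [IsFinite f] [IsAffine T] in
/-- Transport of the Fitting ideal of sections along an equality of opens. [folklore] -/
theorem fittingIdeal_sections_congr {V V' : S.Opens} (h : V' = V) (k : ℕ) :
    (letI := (f.app V').hom.toAlgebra; Module.fittingIdeal Γ(S, V') Γ(X, f ⁻¹ᵁ V') k) =
      (letI := (f.app V).hom.toAlgebra; Module.fittingIdeal Γ(S, V) Γ(X, f ⁻¹ᵁ V) k).map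
        (S.presheaf.map (eqToHom h).op).hom := by
  subst h
  rw [eqToHom_refl, op_id, S.presheaf.map_id]
  exact (Ideal.map_id _).symm

/-- Transport of a Fitting ideal along a ring isomorphism of the module compatible with the
structure maps (same base ring). [folklore] -/
theorem fittingIdeal_eq_of_ringEquiv_comp {A M M' : Type u} [CommRing A] [CommRing M] [CommRing M']
    (φ : A →+* M) (θ : M ≃+* M') (k : ℕ) :
    (letI := (θ.toRingHom.comp φ).toAlgebra; Module.fittingIdeal A M' k) =
      (letI := φ.toAlgebra; Module.fittingIdeal A M k) := by
  letI alg1 : Algebra A M := φ.toAlgebra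
  letI alg2 : Algebra A M' := (θ.toRingHom.comp φ).toAlgebra
  have h := fittingIdeal_map_ringEquiv (R := A) (R' := A) (M := M) (M' := M') (RingEquiv.refl A)
    θ.toAddEquiv (fun a m => by
      change θ (φ a * m) = θ (φ a) * θ m
      rw [map_mul]) k
  rw [← h]
  change Ideal.map (RingHom.id A) (Module.fittingIdeal A M k) = _
  rw [Ideal.map_id]

/-- `fittingIdeal_eq_of_ringEquiv_comp` in `CommRingCat` form: structure maps `ψ = φ ≫ θ` with
`θ` an isomorphism give the same Fitting ideals. [folklore] -/
theorem fittingIdeal_eq_of_comp_iso {A M M' : CommRingCat.{u}} (φ : A ⟶ M) (θ : M ≅ M') (ψ : A ⟶ M')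
    (hψ : ψ = φ ≫ θ.hom) (k : ℕ) :
    (letI := ψ.hom.toAlgebra; Module.fittingIdeal A M' k) =
      (letI := φ.hom.toAlgebra; Module.fittingIdeal A M k) := by
  subst hψ
  exact fittingIdeal_eq_of_ringEquiv_comp φ.hom θ.commRingCatIsoToRingEquiv k

/-- **The Fitting ideal sheaf on an affine chart of a base change**: for `f` finite, an affine
scheme `T` with a morphism `ι : T → S` landing in an affine open `W`, and every `k`, the ideal
of global sections of `Fit_k(f_*𝒪_X)|_T` is the `k`-th Fitting ideal over `Γ(T)` of
`Γ(X ×_S T)` — the sections module of the finite `X ×_S T → T` — since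
`Γ(X ×_S T) = Γ(T) ⊗_{Γ(S, W)} Γ(X, f⁻¹W)`. [cite: StacksProject, Tag 0C3D] -/
theorem fittingIdealSheaf_comap_ideal_top_of_le (W : S.affineOpens)
    (hW : (⊤ : T.Opens) ≤ ι ⁻¹ᵁ (W : S.Opens)) (k : ℕ) :
    ((f.fittingIdealSheaf k).comap ι).ideal ⟨⊤, isAffineOpen_top T⟩ =
      (letI := (pullback.snd f ι).appTop.hom.toAlgebra;
        Module.fittingIdeal Γ(T, ⊤) Γ(pullback f ι, ⊤) k) := by
  -- the affine schemes `W` and `f⁻¹W` and the factorisation `ι = ι_W ≫ W.ι`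
  haveI : IsAffine ((W : S.Opens) : Scheme.{u}) := W.2
  haveI : IsAffine ((f ⁻¹ᵁ (W : S.Opens) : X.Opens) : Scheme.{u}) := W.2.preimage f
  have hrange : Set.range ι ⊆ Set.range (W : S.Opens).ι := by
    rw [Scheme.Opens.range_ι]
    rintro _ ⟨t, rfl⟩
    exact hW (Set.mem_univ t)
  let ιW : T ⟶ (W : S.Opens) := IsOpenImmersion.lift (W : S.Opens).ι ι hrange
  have hιW : ιW ≫ (W : S.Opens).ι = ι := IsOpenImmersion.lift_fac _ _ _
  -- the cartesian square `X ×_S T → f⁻¹W` over `T → W`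
  have t := (isPullback_morphismRestrict f (W : S.Opens)).flip
  have s : IsPullback (pullback.fst f ι) (pullback.snd f ι) f (ιW ≫ (W : S.Opens).ι) := by
    rw [hιW]
    exact IsPullback.of_hasPullback f ι
  have hsq := IsPullback.of_right' s t
  -- sections: a pushout square of rings
  have hpo := isPushout_appTop_of_isPullback hsq
  have hfin : (f ∣_ (W : S.Opens)).appTop.hom.Finite := (f ∣_ (W : S.Opens)).finite_appTop
  have hFit := fittingIdeal_eq_map_of_isPushout hpo hfin k
  -- LHS via the factorisation `ι = ι_W ≫ W.ι`
  rw [ideal_comap_of_le ι (f.fittingIdealSheaf k) W ⟨⊤, isAffineOpen_top T⟩ hW, fittingIdealSheaf_ideal]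
  have happLE : ι.appLE (W : S.Opens) ⊤ hW =
      S.presheaf.map (eqToHom (W : S.Opens).ι_image_top).op ≫ ιW.appTop := by
    have h1 : ι.appLE (W : S.Opens) ⊤ hW = (ιW ≫ (W : S.Opens).ι).appLE (W : S.Opens) ⊤
        (by rw [hιW]; exact hW) := by
      simp only [hιW]
    rw [h1, ← Scheme.Hom.appLE_comp_appLE _ _ (W : S.Opens) ⊤ ⊤ (by
      rw [← SetLike.coe_subset_coe]; simp) le_rfl, Scheme.Opens.ι_appLE]
    congr 1
    rw [Scheme.Hom.appTop, Scheme.Hom.app_eq_appLE]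
    rfl
  rw [happLE, CommRingCat.hom_comp, ← Ideal.map_map, ← fittingIdeal_sections_congr f, hFit]
  -- RHS via the pushout square, transporting `(f ∣_ W).appTop = f.app (W.ι(⊤)) ≫ θ`
  congr 1
  exact (fittingIdeal_eq_of_comp_iso (f.app ((W : S.Opens).ι ''ᵁ ⊤))
    (X.presheaf.mapIso (eqToIso (image_morphismRestrict_preimage f (W : S.Opens) ⊤)).op)
    (f ∣_ (W : S.Opens)).appTop (morphismRestrict_appTop f (W : S.Opens)) k).symm

end Chart

/-! ## Rank strata pull back -/

section Strata

variable {X S S₁ : Scheme.{u}} (f : X ⟶ S) [IsFinite f] (b : S₁ ⟶ S)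

/-- **The rank strata pull back**: for `f` finite and any `b : S₁ → S`,
`b⁻¹(S_r(f)) ⊆ S_r(X ×_S S₁ → S₁)` — on an affine `W₁ ⊆ b⁻¹W`, `W ⊆ S_r(f)` affine, the Fitting
ideals of `Γ(X ×_S S₁)` over `Γ(W₁)` are the extensions of those of `Γ(X, f⁻¹W)` over `Γ(W)`
(`fittingIdealSheaf_comap_ideal_top_of_le` on both sides), hence `Fit_r = 𝒪`, `Fit_k = 0`.
[cite: StacksProject, Tag 0811 (proof)] -/
theorem preimage_rankStratum_le (r : ℕ) :
    b ⁻¹ᵁ f.rankStratum r ≤ (pullback.snd f b).rankStratum r := by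
  intro p₁ hp₁
  -- affine `W ∋ b p₁` inside `S_r(f)` and affine `W₁ ∋ p₁` inside `b⁻¹ W`
  obtain ⟨W, hW, hbpW, hWS⟩ := exists_isAffineOpen_mem_and_subset (X := S) (x := b p₁)
    (U := f.rankStratum r) hp₁
  obtain ⟨W₁, hW₁, hpW₁, hW₁W⟩ := exists_isAffineOpen_mem_and_subset (X := S₁) (x := p₁)
    (U := b ⁻¹ᵁ W) hbpW
  haveI : IsAffine (W₁ : Scheme.{u}) := hW₁
  have hrank := fittingRank_of_le_rankStratum f r ⟨W, hW⟩ hWS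
  -- the Fitting ideals over `Γ(W₁)` of the chart `X ×_S W₁`, computed from `S` and from `S₁`
  let ι : (W₁ : Scheme.{u}) ⟶ S := W₁.ι ≫ b
  have hι : (⊤ : (W₁ : Scheme.{u}).Opens) ≤ ι ⁻¹ᵁ W := by
    rintro x -
    show (W₁.ι ≫ b) x ∈ W
    rw [Scheme.Hom.comp_apply, Scheme.Opens.ι_apply]
    exact hW₁W x.2
  have hS : ∀ k, ((f.fittingIdealSheaf k).comap ι).ideal ⟨⊤, isAffineOpen_top _⟩ =
      (letI := (pullback.snd f ι).appTop.hom.toAlgebra;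
        Module.fittingIdeal Γ(W₁, ⊤) Γ(pullback f ι, ⊤) k) := fun k =>
    fittingIdealSheaf_comap_ideal_top_of_le f ι ⟨W, hW⟩ hι k
  have hS₁ : ∀ k, (((pullback.snd f b).fittingIdealSheaf k).comap W₁.ι).ideal ⟨⊤, isAffineOpen_top _⟩ =
      (letI := (pullback.snd (pullback.snd f b) W₁.ι).appTop.hom.toAlgebra;
        Module.fittingIdeal Γ(W₁, ⊤) Γ(pullback (pullback.snd f b) W₁.ι, ⊤) k) := fun k =>
    fittingIdealSheaf_comap_ideal_top (pullback.snd f b) W₁.ι k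
  -- `(X ×_S S₁) ×_{S₁} W₁ ≅ X ×_S W₁` over `W₁`: the two Fitting ideals agree
  let e := pullbackLeftPullbackSndIso f b W₁.ι
  let θ : Γ(pullback f ι, ⊤) ≅ Γ(pullback (pullback.snd f b) W₁.ι, ⊤) := Scheme.Γ.mapIso e.op
  have hψ : (pullback.snd (pullback.snd f b) W₁.ι).appTop = (pullback.snd f ι).appTop ≫ θ.hom := by
    change _ = _ ≫ e.hom.appTop
    rw [← Scheme.Hom.comp_appTop, pullbackLeftPullbackSndIso_hom_snd]
  have hFit : ∀ k, (((pullback.snd f b).fittingIdealSheaf k).comap W₁.ι).ideal ⟨⊤, isAffineOpen_top _⟩ =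
      ((f.fittingIdealSheaf k).ideal ⟨W, hW⟩).map (ι.appLE W ⊤ hι).hom := fun k => by
    rw [hS₁, fittingIdeal_eq_of_comp_iso (pullback.snd f ι).appTop θ _ hψ k, ← hS,
      ideal_comap_of_le ι (f.fittingIdealSheaf k) ⟨W, hW⟩ ⟨⊤, isAffineOpen_top _⟩ hι]
  -- from `⊤` of `W₁` to the affine open `W₁` of `S₁`
  let Ta : (W₁ : Scheme.{u}).affineOpens := ⟨⊤, isAffineOpen_top _⟩
  have hWa : (⟨W₁.ι ''ᵁ (Ta : (W₁ : Scheme.{u}).Opens), Ta.2.image_of_isOpenImmersion W₁.ι⟩ :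
      S₁.affineOpens) = ⟨W₁, hW₁⟩ := Subtype.ext W₁.ι_image_top
  have hval : ∀ k, (((pullback.snd f b).fittingIdealSheaf k).ideal
      ⟨W₁.ι ''ᵁ (Ta : (W₁ : Scheme.{u}).Opens), Ta.2.image_of_isOpenImmersion W₁.ι⟩).comap
      (W₁.ι.appIso ⊤).inv.hom = ((f.fittingIdealSheaf k).ideal ⟨W, hW⟩).map (ι.appLE W ⊤ hι).hom :=
    fun k => by
    rw [← hFit k, Scheme.IdealSheafData.ideal_comap_of_isOpenImmersion]
  have hbij : Function.Bijective (W₁.ι.appIso ⊤).inv.hom :=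
    ConcreteCategory.bijective_of_isIso (W₁.ι.appIso ⊤).inv
  -- `Fit_r = 𝒪` and `Fit_k = 0` (`k < r`) on `W₁`
  have htop : ((pullback.snd f b).fittingIdealSheaf r).ideal ⟨W₁, hW₁⟩ = ⊤ := by
    rw [← hWa]
    exact Ideal.comap_eq_top_iff.mp (by rw [hval, hrank.1, Ideal.map_top])
  have hbot : ∀ k < r, ((pullback.snd f b).fittingIdealSheaf k).ideal ⟨W₁, hW₁⟩ = ⊥ := fun k hk => by
    rw [← hWa]
    exact Ideal.comap_injective_of_surjective _ hbij.surjective (by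
      rw [hval, hrank.2 k hk, Ideal.map_bot, Ideal.comap_bot_of_injective _ hbij.injective])
  refine ⟨fun hps => ?_, (le_iInf fun k : Fin r =>
    le_vanishingOpen ((pullback.snd f b).fittingIdealSheaf k) (hbot k k.2)) hpW₁⟩
  rw [SetLike.mem_coe, Scheme.IdealSheafData.mem_support_iff_of_mem (U := ⟨W₁, hW₁⟩) hpW₁,
    Scheme.mem_zeroLocus_iff] at hps
  exact hps 1 (htop ▸ Submodule.mem_top) (by rw [Scheme.basicOpen_one]; exact hpW₁)

end Strata



/-! # Part 2 — Preliminaries for the assembly -/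


/-! ## The ideal of a quasi-compact open -/

section KerOpen

variable {S : Scheme.{u}} (T : S.Opens) [QuasiCompact T.ι]

/-- The kernel ideal sheaf of `𝒪_S → ι_*𝒪_T` vanishes on affine opens inside `T`. [folklore] -/
theorem ker_ι_ideal_eq_bot_of_le (W : S.affineOpens) (hW : (W : S.Opens) ≤ T) :
    T.ι.ker.ideal W = ⊥ := by
  rw [Scheme.Hom.ker_apply, Scheme.Opens.ι_app]
  have heq : T.ι ''ᵁ T.ι ⁻¹ᵁ (W : S.Opens) = W := by
    rw [Scheme.Hom.image_preimage_eq_opensRange_inf, Scheme.Opens.opensRange_ι, inf_eq_right.mpr hW]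
  have hiso : IsIso (S.presheaf.map (homOfLE (heq.le : T.ι ''ᵁ T.ι ⁻¹ᵁ (W : S.Opens) ≤ W)).op) := by
    rw [show homOfLE heq.le = eqToHom heq from Subsingleton.elim _ _, eqToHom_op, eqToHom_map]
    infer_instance
  exact (RingHom.injective_iff_ker_eq_bot _).mp
    (ConcreteCategory.bijective_of_isIso (S.presheaf.map (homOfLE heq.le).op)).injective

/-- The kernel ideal sheaf of `𝒪_S → ι_*𝒪_T` is the unit ideal on affine opens missing `T`.
[folklore] -/
theorem ker_ι_ideal_eq_top_of_inf_eq_bot (W : S.affineOpens) (hW : T ⊓ (W : S.Opens) = ⊥) :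
    T.ι.ker.ideal W = ⊤ := by
  rw [Scheme.Hom.ker_apply, eq_top_iff]
  rintro x -
  have heq : T.ι ⁻¹ᵁ (W : S.Opens) = ⊥ := by
    ext y
    simp only [Opens.coe_bot, Set.mem_empty_iff_false, iff_false]
    intro hy
    have : y.1 ∈ (T ⊓ (W : S.Opens) : S.Opens) := ⟨y.2, hy⟩
    rw [hW] at this
    exact this
  haveI : Subsingleton Γ(T, T.ι ⁻¹ᵁ (W : S.Opens)) :=
    CommRingCat.subsingleton_of_isTerminal ((T : Scheme.{u}).sheaf.isTerminalOfEqEmpty heq)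
  exact Subsingleton.elim _ _

end KerOpen

/-! ## The Fitting ideal sheaf restricted to an open -/

section FittingOpen

variable {X S T : Scheme.{u}} (f : X ⟶ S) [IsFinite f] (j : T ⟶ S) [IsOpenImmersion j]

/-- **`Fit_k(f_*𝒪_X)|_T = Fit_k((f_T)_*𝒪_{X_T})`** for an open immersion `j : T → S`: the Fitting
ideal sheaves of a finite morphism restrict, along open immersions, to those of the restricted
morphism `X ×_S T → T`. [cite: StacksProject, Tag 0C3D] -/
theorem fittingIdealSheaf_comap_of_isOpenImmersion (k : ℕ) :
    (f.fittingIdealSheaf k).comap j = (pullback.snd f j).fittingIdealSheaf k := by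
  apply Scheme.IdealSheafData.ext
  funext W
  let Wo : T.Opens := W
  haveI : IsAffine (Wo : Scheme.{u}) := W.2
  -- compare the values at `⊤` of the affine scheme `W` after pulling back along `W.ι`
  let ι : (Wo : Scheme.{u}) ⟶ S := Wo.ι ≫ j
  let Wj : S.affineOpens := ⟨j ''ᵁ Wo, W.2.image_of_isOpenImmersion j⟩
  have hι : (⊤ : (Wo : Scheme.{u}).Opens) ≤ ι ⁻¹ᵁ (Wj : S.Opens) := by
    rintro x -
    show (Wo.ι ≫ j) x ∈ j ''ᵁ Wo
    rw [Scheme.Hom.comp_apply, Scheme.Opens.ι_apply]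
    exact ⟨x.1, x.2, rfl⟩
  have h1 : (((f.fittingIdealSheaf k).comap j).comap Wo.ι).ideal ⟨⊤, isAffineOpen_top _⟩ =
      (letI := (pullback.snd f ι).appTop.hom.toAlgebra;
        Module.fittingIdeal Γ(Wo, ⊤) Γ(pullback f ι, ⊤) k) := by
    rw [← Scheme.IdealSheafData.comap_comp]
    exact fittingIdealSheaf_comap_ideal_top_of_le f ι Wj hι k
  have h2 : (((pullback.snd f j).fittingIdealSheaf k).comap Wo.ι).ideal ⟨⊤, isAffineOpen_top _⟩ =
      (letI := (pullback.snd (pullback.snd f j) Wo.ι).appTop.hom.toAlgebra;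
        Module.fittingIdeal Γ(Wo, ⊤) Γ(pullback (pullback.snd f j) Wo.ι, ⊤) k) :=
    fittingIdealSheaf_comap_ideal_top (pullback.snd f j) Wo.ι k
  let e := pullbackLeftPullbackSndIso f j Wo.ι
  let θ : Γ(pullback f ι, ⊤) ≅ Γ(pullback (pullback.snd f j) Wo.ι, ⊤) := Scheme.Γ.mapIso e.op
  have hψ : (pullback.snd (pullback.snd f j) Wo.ι).appTop = (pullback.snd f ι).appTop ≫ θ.hom := by
    change _ = _ ≫ e.hom.appTop
    rw [← Scheme.Hom.comp_appTop, pullbackLeftPullbackSndIso_hom_snd]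
  have h12 : (((f.fittingIdealSheaf k).comap j).comap Wo.ι).ideal ⟨⊤, isAffineOpen_top _⟩ =
      (((pullback.snd f j).fittingIdealSheaf k).comap Wo.ι).ideal ⟨⊤, isAffineOpen_top _⟩ := by
    rw [h1, h2, fittingIdeal_eq_of_comp_iso (pullback.snd f ι).appTop θ _ hψ k]
  -- descend from `⊤` of `W` to the affine open `W` of `T`
  let Ta : (Wo : Scheme.{u}).affineOpens := ⟨⊤, isAffineOpen_top _⟩
  have hWa : (⟨Wo.ι ''ᵁ (Ta : (Wo : Scheme.{u}).Opens), Ta.2.image_of_isOpenImmersion Wo.ι⟩ :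
      T.affineOpens) = W := Subtype.ext Wo.ι_image_top
  rw [Scheme.IdealSheafData.ideal_comap_of_isOpenImmersion ((f.fittingIdealSheaf k).comap j),
    Scheme.IdealSheafData.ideal_comap_of_isOpenImmersion ((pullback.snd f j).fittingIdealSheaf k)]
    at h12
  rw [← hWa]
  exact Ideal.comap_injective_of_surjective _
    (ConcreteCategory.bijective_of_isIso (Wo.ι.appIso ⊤).inv).surjective h12

end FittingOpen

/-! ## Blowing ups of qcqs schemes in finite type centres are qcqs -/

section Instances

variable {S S' : Scheme.{u}} {b : S' ⟶ S} {C : S.IdealSheafData}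

/-- A blowing up of a quasi-compact scheme in a finite type centre is quasi-compact. [folklore] -/
theorem compactSpace_of_isBlowup_of_fg [CompactSpace S] (hb : IsBlowup b C)
    (hC : ∀ W : S.affineOpens, (C.ideal W).FG) : CompactSpace S' := by
  haveI : IsProper b := IsBlowup.isProper_of_fg hC hb
  exact QuasiCompact.compactSpace_of_compactSpace b

/-- A blowing up of a quasi-compact quasi-separated scheme in a finite type centre is
quasi-separated. [folklore] -/
theorem quasiSeparatedSpace_of_isBlowup_of_fg [CompactSpace S] [QuasiSeparatedSpace S]
    (hb : IsBlowup b C) (hC : ∀ W : S.affineOpens, (C.ideal W).FG) : QuasiSeparatedSpace S' := by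
  haveI : IsProper b := IsBlowup.isProper_of_fg hC hb
  exact quasiSeparatedSpace_of_quasiSeparated b

/-- A quasi-compact open of a scheme is a quasi-compact scheme. [folklore] -/
theorem compactSpace_of_isCompact {U : S.Opens} (hU : IsCompact (U : Set S)) :
    CompactSpace (U : Scheme.{u}) :=
  isCompact_iff_compactSpace.mp hU

end Instances


/-! # Part 3 — The theorem -/


/-! ## Small helpers -/

section Helpers

variable {X : Scheme.{u}}

/-- Section ideals of a finite product of ideal sheaves (a `private` copy of
`idealSheafData_ideal_prod` of `KollarTuning.lean`, kept local so as not to couple the flattening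
chain to the Kollár-tuning chain). [folklore] -/
private theorem ideal_finset_prod {ι : Type*} (s : Finset ι) (I : ι → X.IdealSheafData) (W : X.affineOpens) :
    (∏ i ∈ s, I i).ideal W = ∏ i ∈ s, (I i).ideal W := by
  classical
  induction s using Finset.induction_on with
  | empty => simp [show (1 : X.IdealSheafData) = ⊤ from rfl, Scheme.IdealSheafData.ideal_top]
  | insert a s ha ih =>
    rw [Finset.prod_insert ha, Finset.prod_insert ha, Scheme.IdealSheafData.ideal_mul, Pi.mul_apply, ih]

/-- An affine open on which an ideal sheaf is the unit ideal misses its support. [folklore] -/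
theorem not_mem_support_of_ideal_eq_top {I : X.IdealSheafData} {W : X.affineOpens}
    (h : I.ideal W = ⊤) {x : X} (hx : x ∈ (W : X.Opens)) : x ∉ I.support := fun hxs => by
  rw [Scheme.IdealSheafData.mem_support_iff_of_mem hx, Scheme.mem_zeroLocus_iff] at hxs
  exact hxs 1 (h ▸ Submodule.mem_top) (by rw [Scheme.basicOpen_one]; exact hx)

end Helpers

/-! ## The theorem -/

set_option maxHeartbeats 800000 in
/-- **Stacks 081R (Raynaud–Gruson 5.2.2) for finite morphisms of finite presentation.** Let `S`
be quasi-compact and quasi-separated, `f : X → S` finite and locally of finite presentation, and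
`U ⊆ S` a quasi-compact open such that `X_U → U` is flat. Then there exist an ideal sheaf of
finite type `𝓘` on `S` with `V(𝓘) = S ∖ U` (set-theoretically), and a blowing up `b : S' → S`
of `S` in `𝓘` — a `U`-admissible blowing up — such that the strict transform of `X` along `b` is
flat and locally of finite presentation over `S'`. (The named fact `Stacks081R` has `f` merely of
finite type and quasi-separated, with `X_U → U` flat and locally of finite presentation, and asks
for `V(𝓘) ∩ U = ∅`.)
[cite: StacksProject, Tag 081R; RaynaudGruson1971, Première partie Thm. 5.2.2] -/
theorem exists_isBlowup_support_eq_flat_lfp_of_isFinite {X S : Scheme.{u}} (f : X ⟶ S)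
    [IsFinite f] [LocallyOfFinitePresentation f] [CompactSpace S] [QuasiSeparatedSpace S]
    (U : S.Opens) (hU : IsCompact (U : Set S)) [Flat (f ∣_ U)] :
    ∃ (I : S.IdealSheafData) (S' : Scheme.{u}) (b : S' ⟶ S),
      (∀ W : S.affineOpens, (I.ideal W).FG) ∧ (I.support : Set S) = (U : Set S)ᶜ ∧
      IsBlowup b I ∧ Flat (blowupStrictTransformMap f b I) ∧
      LocallyOfFinitePresentation (blowupStrictTransformMap f b I) := by
  classical
  /- Step 1: finitely many rank strata cover `U` -/
  have hcov : U ≤ ⨆ r : ℕ, f.rankStratum r := le_iSup_rankStratum_of_flat f U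
  obtain ⟨t, ht⟩ := hU.elim_finite_subcover (fun r : ℕ => ((f.rankStratum r : S.Opens) : Set S))
    (fun r => (f.rankStratum r).2) (fun x hx => by
      have := hcov hx
      rw [Opens.mem_iSup] at this
      exact Set.mem_iUnion.mpr this)
  let N : ℕ := t.sup id + 1
  have htN : ∀ r ∈ t, r < N := fun r hr => Nat.lt_succ_of_le (Finset.le_sup (f := id) hr)
  let V : Fin N → S.Opens := fun i => U ⊓ f.rankStratum i
  have hVU : ∀ i, V i ≤ U := fun i => inf_le_left
  have hVdisj : ∀ i j, i ≠ j → Disjoint (V i) (V j) := fun i j hij => by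
    rw [disjoint_iff, ← le_bot_iff]
    calc V i ⊓ V j ≤ f.rankStratum i ⊓ f.rankStratum j := inf_le_inf inf_le_right inf_le_right
      _ = ⊥ := rankStratum_inf_rankStratum_eq_bot f (fun h => hij (Fin.ext h))
  have hVcov : ∀ x ∈ U, ∃ i, x ∈ V i := fun x hx => by
    obtain ⟨r, hr⟩ := Set.mem_iUnion.mp (ht hx)
    obtain ⟨hrt, hxr⟩ := Set.mem_iUnion.mp hr
    exact ⟨⟨r, htN r hrt⟩, hx, hxr⟩
  have hVcpt : ∀ i, IsCompact (V i : Set S) := fun i => by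
    have hVeq : (V i : Set S) = (U : Set S) ∩ (⋃ j : {j : Fin N // j ≠ i},
        ((f.rankStratum (j : Fin N) : S.Opens) : Set S))ᶜ := by
      ext x
      constructor
      · rintro ⟨hxU, hxi⟩
        refine ⟨hxU, fun hx => ?_⟩
        obtain ⟨j, hxj⟩ := Set.mem_iUnion.mp hx
        have : x ∈ (f.rankStratum i ⊓ f.rankStratum (j : Fin N) : S.Opens) := ⟨hxi, hxj⟩
        rw [rankStratum_inf_rankStratum_eq_bot f (fun h => j.2 (Fin.ext h).symm)] at this
        exact this
      · rintro ⟨hxU, hx⟩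
        obtain ⟨j, hxj⟩ := hVcov x hxU
        by_cases hji : j = i
        · exact hji ▸ hxj
        · exact (hx (Set.mem_iUnion.mpr ⟨⟨j, hji⟩, hxj.2⟩)).elim
    rw [hVeq]
    exact hU.inter_right (isOpen_iUnion fun j => (f.rankStratum _).2).isClosed_compl
  /- Step 2: the first blowing up, separating the strata, with centre supported on `S ∖ U` -/
  obtain ⟨C₁, S₁', b₁', T', hC₁fg, hC₁U, hb₁', hT'cov, hT'disj, hVT'⟩ :=
    exists_isBlowup_separating_finite V hVcpt hVdisj
  obtain ⟨K, hKfg, hKsupp⟩ := exists_fg_support_eq_compl U hU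
  let P : S.IdealSheafData := K * C₁
  have hPfg : ∀ W : S.affineOpens, (P.ideal W).FG := fun W => by
    rw [Scheme.IdealSheafData.ideal_mul, Pi.mul_apply]
    exact (hKfg W).mul (hC₁fg W)
  have hPsupp : (P.support : Set S) = (U : Set S)ᶜ := by
    apply Set.Subset.antisymm
    · rw [Scheme.IdealSheafData.support_mul, Closeds.coe_sup, hKsupp, Set.union_subset_iff]
      refine ⟨subset_rfl, fun x hxC hxU => ?_⟩
      obtain ⟨i, hxi⟩ := hVcov x hxU
      exact Set.disjoint_left.mp hC₁U (Opens.mem_iSup.mpr ⟨i, hxi⟩) hxC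
    · rw [← hKsupp, Scheme.IdealSheafData.support_mul, Closeds.coe_sup]
      exact Set.subset_union_left
  have hPU : centreCompl P = U := centreCompl_eq_of_support_eq hPsupp
  obtain ⟨S₁, b₁, hb₁⟩ := Stacks01OG_holds S P
  haveI : CompactSpace S₁ := compactSpace_of_isBlowup_of_fg hb₁ hPfg
  haveI : QuasiSeparatedSpace S₁ := quasiSeparatedSpace_of_isBlowup_of_fg hb₁ hPfg
  -- `b₁` dominates the separating blowing up
  have hC₁cart : IsEffectiveCartier (C₁.comap b₁) := by
    have h := hb₁.isEffectiveCartier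
    rw [show P = K * C₁ from rfl, comap_mul] at h
    exact h.of_mul_right
  let π : S₁ ⟶ S₁' := hb₁'.lift b₁ hC₁cart
  have hπ : π ≫ b₁' = b₁ := hb₁'.lift_comp b₁ hC₁cart
  let T : Fin N → S₁.Opens := fun i => π ⁻¹ᵁ T' i
  have hTcov : (⨆ i, T i) = ⊤ := by
    simp only [T, ← Scheme.Hom.preimage_iSup, hT'cov, Scheme.Hom.preimage_top]
  have hTdisj : ∀ i j, i ≠ j → T i ⊓ T j = ⊥ := fun i j hij => by
    simp only [T, ← Scheme.Hom.preimage_inf, hT'disj i j hij, Scheme.Hom.preimage_bot]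
  have hVT : ∀ i, b₁ ⁻¹ᵁ V i ≤ T i := fun i => by
    simp only [T, ← hπ, Scheme.Hom.comp_preimage]
    exact Scheme.Hom.preimage_mono π (hVT' i)
  have hTclosed : ∀ i, IsClosed (T i : Set S₁) := fun i => by
    have : (T i : Set S₁) = (⋃ j : {j : Fin N // j ≠ i}, ((T (j : Fin N) : S₁.Opens) : Set S₁))ᶜ := by
      ext x
      constructor
      · intro hxi hx
        obtain ⟨j, hxj⟩ := Set.mem_iUnion.mp hx
        have : x ∈ (T i ⊓ T (j : Fin N) : S₁.Opens) := ⟨hxi, hxj⟩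
        rw [hTdisj i j (fun h => j.2 h.symm)] at this
        exact this
      · intro hx
        have hxtop : x ∈ (⊤ : S₁.Opens) := trivial
        rw [← hTcov, Opens.mem_iSup] at hxtop
        obtain ⟨j, hxj⟩ := hxtop
        by_cases hji : j = i
        · exact hji ▸ hxj
        · exact (hx (Set.mem_iUnion.mpr ⟨⟨j, hji⟩, hxj⟩)).elim
    rw [this]
    exact (isOpen_iUnion fun j => (T _).2).isClosed_compl
  have hTcpt : ∀ i, IsCompact (T i : Set S₁) := fun i => (hTclosed i).isCompact
  haveI hTqc : ∀ i, QuasiCompact (T i).ι := fun i => Limits.quasiCompact_ι_of_isCompact (T i) (hTcpt i)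
  /- Step 3: the second blowing up, on `S₁` -/
  let f₁ := pullback.snd f b₁
  let U₁ : S₁.Opens := b₁ ⁻¹ᵁ U
  let K₁ : S₁.IdealSheafData := P.comap b₁
  have hK₁fg : ∀ W : S₁.affineOpens, (K₁.ideal W).FG := fun W => fg_ideal_comap b₁ hPfg W
  have hK₁supp : (K₁.support : Set S₁) = (U₁ : Set S₁)ᶜ := by
    simp only [K₁, Scheme.IdealSheafData.support_comap, Closeds.coe_preimage, hPsupp,
      Set.preimage_compl]
    rfl
  have hK₁U : centreCompl K₁ = U₁ := centreCompl_eq_of_support_eq hK₁supp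
  -- rank `i` on `U₁ ∩ T_i`
  have hstrat : ∀ i, U₁ ⊓ T i ≤ f₁.rankStratum i := fun i x ⟨hxU, hxT⟩ => by
    obtain ⟨j, hxj⟩ := hVcov (b₁ x) hxU
    have hxTj : x ∈ T j := hVT j hxj
    have hji : j = i := by
      by_contra hji
      have : x ∈ (T j ⊓ T i : S₁.Opens) := ⟨hxTj, hxT⟩
      rw [hTdisj j i hji] at this
      exact this
    subst hji
    exact preimage_rankStratum_le f b₁ j (show b₁ x ∈ f.rankStratum j from hxj.2)
  -- the centre `𝓚₁ · ∏ᵢ (𝓛ᵢ + 𝓚₁ · Fitᵢ)`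
  let L : Fin N → S₁.IdealSheafData := fun i => (T i).ι.ker
  let M : Fin N → S₁.IdealSheafData := fun i => L i ⊔ K₁ * f₁.fittingIdealSheaf i
  let C₂ : S₁.IdealSheafData := K₁ * ∏ i, M i
  have hMT : ∀ (j : Fin N) (W : S₁.affineOpens), (W : S₁.Opens) ≤ T j →
      ∀ i, (M i).ideal W = if i = j then (K₁ * f₁.fittingIdealSheaf j).ideal W else ⊤ := by
    intro j W hW i
    simp only [M, Scheme.IdealSheafData.ideal_sup, Pi.sup_apply]
    split_ifs with hij
    · subst hij
      rw [show (L i).ideal W = ⊥ from ker_ι_ideal_eq_bot_of_le (T i) W hW, bot_sup_eq]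
    · rw [show (L i).ideal W = ⊤ from ker_ι_ideal_eq_top_of_inf_eq_bot (T i) W
        (le_bot_iff.mp ((inf_le_inf_left _ hW).trans (hTdisj i j hij).le)), top_sup_eq]
  have hC₂T : ∀ (j : Fin N) (W : S₁.affineOpens), (W : S₁.Opens) ≤ T j →
      C₂.ideal W = (K₁ ^ 2 * f₁.fittingIdealSheaf j).ideal W := by
    intro j W hW
    have hR : (K₁ ^ 2 * f₁.fittingIdealSheaf j).ideal W =
        K₁.ideal W * (K₁.ideal W * (f₁.fittingIdealSheaf j).ideal W) := by
      rw [Scheme.IdealSheafData.ideal_mul, Pi.mul_apply, Scheme.IdealSheafData.ideal_pow,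
        Pi.pow_apply, sq, mul_assoc]
    rw [hR, show C₂ = K₁ * ∏ i, M i from rfl, Scheme.IdealSheafData.ideal_mul, Pi.mul_apply,
      ideal_finset_prod]
    simp only [hMT j W hW, ← Ideal.one_eq_top, Finset.prod_ite_eq', Finset.mem_univ, if_true,
      Scheme.IdealSheafData.ideal_mul, Pi.mul_apply]
  have hC₂fg : ∀ W : S₁.affineOpens, (C₂.ideal W).FG := fun W =>
    Limits.fg_ideal_of_le_iSup C₂ T (fun j W' hW' => by
      rw [hC₂T j W' hW', Scheme.IdealSheafData.ideal_mul, Pi.mul_apply,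
        Scheme.IdealSheafData.ideal_pow, Pi.pow_apply]
      exact (hK₁fg W').pow.mul (fg_ideal_fittingIdealSheaf f₁ j W')) W (hTcov.symm ▸ le_top)
  have hC₂supp : (C₂.support : Set S₁) = (U₁ : Set S₁)ᶜ := by
    apply Set.Subset.antisymm
    · intro x hxC hxU
      have hxtop : x ∈ (⊤ : S₁.Opens) := trivial
      rw [← hTcov, Opens.mem_iSup] at hxtop
      obtain ⟨j, hxj⟩ := hxtop
      obtain ⟨W, hW, hxW, hWle⟩ := exists_isAffineOpen_mem_and_subset (X := S₁) (x := x)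
        (U := U₁ ⊓ T j) ⟨hxU, hxj⟩
      refine not_mem_support_of_ideal_eq_top (W := ⟨W, hW⟩) ?_ hxW hxC
      have hWU : (W : S₁.Opens) ≤ U₁ := fun y hy => (hWle hy).1
      have hWT : (W : S₁.Opens) ≤ T j := fun y hy => (hWle hy).2
      rw [hC₂T j ⟨W, hW⟩ hWT, Scheme.IdealSheafData.ideal_mul, Pi.mul_apply,
        Scheme.IdealSheafData.ideal_pow, Pi.pow_apply,
        ideal_eq_top_of_le_centreCompl K₁ ⟨W, hW⟩ (hK₁U.symm ▸ hWU),
        (fittingRank_of_le_rankStratum f₁ j ⟨W, hW⟩ (fun y hy => hstrat j (hWle hy))).1]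
      simp
    · rw [← hK₁supp]
      simp only [C₂, Scheme.IdealSheafData.support_mul, Closeds.coe_sup]
      exact Set.subset_union_left
  have hC₂U : centreCompl C₂ = U₁ := centreCompl_eq_of_support_eq hC₂supp
  obtain ⟨S₂, b₂, hb₂⟩ := Stacks01OG_holds S₁ C₂
  -- flatness and finite presentation of the strict transform of `f₁` along `b₂`, piece by piece
  have hpiece : ∀ j : Fin N,
      Flat (blowupStrictTransformMap (pullback.snd f₁ (T j).ι) (pullback.snd b₂ (T j).ι)
        (C₂.comap (T j).ι)) ∧
      LocallyOfFinitePresentation (blowupStrictTransformMap (pullback.snd f₁ (T j).ι)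
        (pullback.snd b₂ (T j).ι) (C₂.comap (T j).ι)) := fun j => by
    let fT := pullback.snd f₁ (T j).ι
    let KT : (T j : Scheme.{u}).IdealSheafData := (K₁ ^ 2).comap (T j).ι
    have hC₂comap : C₂.comap (T j).ι = KT * fT.fittingIdealSheaf j := by
      rw [show C₂.comap (T j).ι = (K₁ ^ 2 * f₁.fittingIdealSheaf j).comap (T j).ι from
        Limits.comap_ι_eq_of_forall_ideal_eq (hC₂T j), comap_mul,
        fittingIdealSheaf_comap_of_isOpenImmersion]
    rw [hC₂comap]
    haveI : CompactSpace (T j : Scheme.{u}) := compactSpace_of_isCompact (hTcpt j)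
    have hKTfg : ∀ W : (T j : Scheme.{u}).affineOpens, (KT.ideal W).FG := fun W =>
      fg_ideal_comap (T j).ι (fun W' => by
        rw [Scheme.IdealSheafData.ideal_pow, Pi.pow_apply]; exact (hK₁fg W').pow) W
    have hKTsupp : (KT.support : Set (T j)) = (((T j).ι ⁻¹ᵁ U₁ : (T j : Scheme.{u}).Opens) :
        Set (T j))ᶜ := by
      simp only [KT, Scheme.IdealSheafData.support_comap, Closeds.coe_preimage,
        Scheme.IdealSheafData.support_pow_succ, hK₁supp, Set.preimage_compl]
      rfl
    have hrT : ∀ W : (T j : Scheme.{u}).affineOpens, (W : (T j : Scheme.{u}).Opens) ≤ (T j).ι ⁻¹ᵁ U₁ →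
        (fT.fittingIdealSheaf j).ideal W = ⊤ ∧ ∀ k < (j : ℕ), (fT.fittingIdealSheaf k).ideal W = ⊥ :=
      fun W hW => fittingRank_of_le_rankStratum fT j W (hW.trans (fun y hy =>
        preimage_rankStratum_le f₁ (T j).ι j (hstrat j ⟨hy, by
          show (T j).ι y ∈ T j
          rw [Scheme.Opens.ι_apply]
          exact y.2⟩)))
    obtain ⟨-, hrank⟩ := pow_le_and_pow_mul_eq_bot_of_support_eq fT ((T j).ι ⁻¹ᵁ U₁) j hrT KT
      hKTfg hKTsupp
    have hbT : IsBlowup (pullback.snd b₂ (T j).ι) (KT * fT.fittingIdealSheaf j) := by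
      rw [← hC₂comap, ← pullbackRestrictIsoRestrict_hom_morphismRestrict]
      exact (hb₂.restrict (T j)).iso_comp (pullbackRestrictIsoRestrict b₂ (T j))
    exact flat_and_lfp_blowupStrictTransformMap_of_isBlowup fT KT hrank hbT
  have hflat₁ : Flat (blowupStrictTransformMap f₁ b₂ C₂) :=
    blowupStrictTransformMap_of_openCover_base f₁ b₂ C₂ @Flat hb₂.isEffectiveCartier
      (S₁.openCoverOfIsOpenCover T hTcov) fun j => (hpiece j).1
  have hlfp₁ : LocallyOfFinitePresentation (blowupStrictTransformMap f₁ b₂ C₂) :=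
    blowupStrictTransformMap_of_openCover_base f₁ b₂ C₂ @LocallyOfFinitePresentation
      hb₂.isEffectiveCartier (S₁.openCoverOfIsOpenCover T hTcov) fun j => (hpiece j).2
  /- Step 4: compose -/
  obtain ⟨R, hRfg, hb, hsuppR⟩ := hb₁.exists_isBlowup_comp_mul_of_fg hPfg hb₂ hC₂fg
  have hIsupp : ((P * R).support : Set S) = (U : Set S)ᶜ := by
    apply Set.Subset.antisymm
    · refine hsuppR.trans (Set.union_subset (hPsupp.le) ?_)
      rintro _ ⟨y, hy, rfl⟩ hyU
      rw [hC₂supp] at hy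
      exact hy hyU
    · rw [← hPsupp, Scheme.IdealSheafData.support_mul, Closeds.coe_sup]
      exact Set.subset_union_left
  have hIU : centreCompl (P * R) = U := centreCompl_eq_of_support_eq hIsupp
  -- the strict transform of `f` along `b₂ ≫ b₁` is that of `f₁` along `b₂`
  have htransfer : ∀ (Q : MorphismProperty Scheme.{u}) [Q.RespectsIso],
      Q (blowupStrictTransformMap f₁ b₂ C₂) → Q (blowupStrictTransformMap f (b₂ ≫ b₁) (P * R)) := by
    intro Q _ hQ
    haveI : QuasiCompact ((pullback.snd f (b₂ ≫ b₁)) ⁻¹ᵁ ((b₂ ≫ b₁) ⁻¹ᵁ centreCompl (P * R))).ι := by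
      rw [preimage_centreCompl]
      exact quasiCompact_ι_preimage_centreCompl _ hb.isEffectiveCartier
    refine (subschemeι_ker_ι_comp_iff_of_iso (pullbackLeftPullbackSndIso f b₁ b₂).hom
      (pullback.snd f (b₂ ≫ b₁)) (pullback.snd f₁ b₂)
      ((pullback.snd f (b₂ ≫ b₁)) ⁻¹ᵁ ((b₂ ≫ b₁) ⁻¹ᵁ centreCompl (P * R)))
      ((pullback.snd f₁ b₂) ⁻¹ᵁ (b₂ ⁻¹ᵁ centreCompl C₂)) Q
      (pullbackLeftPullbackSndIso_hom_snd f b₁ b₂) ?_).mpr hQ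
    rw [hIU, hC₂U]
    simp only [U₁, ← Scheme.Hom.comp_preimage, pullbackLeftPullbackSndIso_hom_snd_assoc]
    rfl
  exact ⟨P * R, S₂, b₂ ≫ b₁, fun W => by
      rw [Scheme.IdealSheafData.ideal_mul, Pi.mul_apply]
      exact (hPfg W).mul (hRfg W),
    hIsupp, hb, htransfer @Flat hflat₁, htransfer @LocallyOfFinitePresentation hlfp₁⟩

/-- **Stacks 081R (Raynaud–Gruson 5.2.2) for finite morphisms of finite presentation**, with the
conclusion in the literal shape of the named fact `Stacks081R` (`V(𝓘) ∩ U = ∅`).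
[cite: StacksProject, Tag 081R; RaynaudGruson1971, Première partie Thm. 5.2.2] -/
theorem stacks081R_of_isFinite_of_locallyOfFinitePresentation {X S : Scheme.{u}} (f : X ⟶ S)
    [IsFinite f] [LocallyOfFinitePresentation f] [CompactSpace S] [QuasiSeparatedSpace S]
    (U : S.Opens) (hU : IsCompact (U : Set S)) [Flat (f ∣_ U)] :
    ∃ (I : S.IdealSheafData) (S' : Scheme.{u}) (b : S' ⟶ S),
      (∀ W : S.affineOpens, (I.ideal W).FG) ∧ Disjoint (U : Set S) (I.support : Set S) ∧
      IsBlowup b I ∧ Flat (blowupStrictTransformMap f b I) ∧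
      LocallyOfFinitePresentation (blowupStrictTransformMap f b I) := by
  obtain ⟨I, S', b, hIfg, hIsupp, hb, hflat, hlfp⟩ :=
    exists_isBlowup_support_eq_flat_lfp_of_isFinite f U hU
  exact ⟨I, S', b, hIfg, by rw [hIsupp]; exact disjoint_compl_right, hb, hflat, hlfp⟩

/-- **`Stacks081R` restricted to finite morphisms of finite presentation**, in the binder shape
of the named fact (`StrictTransformFlattening.lean`): for `S` qcqs, `f` finite and locally of
finite presentation (in particular quasi-compact, locally of finite type and quasi-separated),
`U ⊆ S` quasi-compact open with `f|_U` flat (and automatically locally of finite presentation),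
the conclusion of `Stacks081R` holds. [cite: StacksProject, Tag 081R; RaynaudGruson1971, Première partie Thm. 5.2.2] -/
theorem stacks081R_of_isFinite ⦃X S : Scheme.{u}⦄ (f : X ⟶ S) [CompactSpace S] [QuasiSeparatedSpace S]
    [IsFinite f] [LocallyOfFinitePresentation f] (U : S.Opens) (hU : IsCompact (U : Set S))
    (hflat : Flat (f ∣_ U)) :
    ∃ (I : S.IdealSheafData) (S' : Scheme.{u}) (b : S' ⟶ S),
      (∀ W : S.affineOpens, (I.ideal W).FG) ∧ Disjoint (U : Set S) (I.support : Set S) ∧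
      IsBlowup b I ∧ Flat (blowupStrictTransformMap f b I) ∧
      LocallyOfFinitePresentation (blowupStrictTransformMap f b I) :=
  stacks081R_of_isFinite_of_locallyOfFinitePresentation f U hU

end Literature.AlgebraicGeometry.Resolution

end
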